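import Summits.BirchSwinnertonDyer.BirchSwinnertonDyer.Theorems.Rank2ObservatoryRootNumberAdditive
import Summits.BirchSwinnertonDyer.BirchSwinnertonDyer.Theorems.Rank2ObservatoryRootNumberArith
import HarnessLib

/-!
# BSD rank ≥ 2 observatory (`b2b-bsdr2`): KERNEL CERTIFICATES for the global root number of an
# integer equation, modulo the tree's named fact `rootNumber_eq_neg_finprod_tableLocalRootNumberAt'`

HONEST FRAMING: per-curve certified theorems and census instruments; no claim on BSD in rank ≥ 2.

Purpose: discharge, in the kernel, the hypothesis `hw : rootNumber = -1` of the cell's rank-3 census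
theorems (`Rank3Row.analyticRank_eq_rank_kernel`, `Rank3Row.rank3_lderiv_eq_zero_kernel`) for every
census curve with no additive reduction at `3`, modulo the tree's NAMED FACT
`WeierstrassCurve.rootNumber_eq_neg_finprod_tableLocalRootNumberAt'` (`RootNumberTableTwo`;
Kellock–Dokchitser 2023, Def. 2.1, Thm. 2.3, §5 Table with rows `(0,5,2)` corrected after Rizzo 2003:
`w(E) = −∏ᵥ W.tableLocalRootNumberAt' v` for an elliptic `W / ℚ` with no additive reduction above
`3`).  A ROOT-NUMBER CERTIFICATE `RNCert` for an integer equation `W₀` lists `v₂(Δ), v₂(c₄), v₂(c₆)`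
and, for every odd prime `p ∣ Δ(W₀)`, a trial-division primality witness, the exponent of `p` in
`Δ`, and one of: a root modulo `p` of the node-tangent quadratic (split multiplicative, `w_p = −1`);
the Euler witness `d^{(p−1)/2} ≡ −1 (mod p)` for its discriminant `d` (non-split, `w_p = +1`); or,
for `p ≥ 5` additive, `ord_p c₄` (with `ord_p Δ < 12` or `ord_p c₄ < 4`: minimality), the sign
being Rohrlich's formula `rohrlichSign` (`Rank2ObservatoryRootNumberAdditive`); the Boolean
`RNCert.check` (decided by the kernel per curve in the census files) verifies all of this together
with the complete factorisation `|Δ| = 2^{v₂(Δ)} ∏ p^{e_p}`.  Soundness: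

* `w2OfInvariants'_intCast` — the corrected `ℚ₂` table value `KellockDokchitser.w2OfInvariants'`
  at integer invariants equals the kernel-computable `w2OfInt` (Notation 5.1 of Kellock–Dokchitser
  read on `2^k ∥ x`: `v₂`, odd parts modulo `64`, the shift `m`);
* `finprod_tableLocalRootNumberAt'_eq_sign` — for a checking certificate,
  `∏ᶠ_v W.tableLocalRootNumberAt' v = RNCert.sign` (the table value at `2` times the certified odd
  local signs), by the place-by-place theorems of `Rank2ObservatoryRootNumberLocal` / `…Additive`;
* `rootNumber_eq_neg_sign` — hence `w(E) = −sign` GIVEN THE NAMED FACT as a hypothesis (its guard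
  at `3` follows from the certificate: `3 ∤ Δ` or `3 ∤ c₄`).

Additive reduction at `3` is not certified (the named fact is guarded there; such census curves keep
the hypothesis `hw`).  References: Kellock–Dokchitser 2023 [KellockDokchitser2023]; Rizzo 2003
[Rizzo2003]; Rohrlich 1993 Prop. 2 [Rohrlich1993Compositio]; Silverman *AEC* VII.5.1
[SilvermanAEC2009].
-/

set_option linter.dupNamespace false
set_option autoImplicit false

open IsDedekindDomain Rat.HeightOneSpectrum WeierstrassCurve Literature.NumberTheory.EllipticCurves
  Literature.NumberTheory.Sieve

namespace Summit.BirchSwinnertonDyer.BirchSwinnertonDyer.Rank2Observatory.RootNumber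

/-! ### Root-number certificates -/

/-- The node-tangent quadratic `c₄t² + a₁c₄t − (54b₆ − 3b₂b₄ + a₂c₄)` of `W₀` at an integer `t`.
[folklore] -/
def nodalValue (W₀ : WeierstrassCurve ℤ) (t : ℤ) : ℤ :=
  W₀.c₄ * t ^ 2 + W₀.a₁ * W₀.c₄ * t - (54 * W₀.b₆ - 3 * W₀.b₂ * W₀.b₄ + W₀.a₂ * W₀.c₄)

/-- Certificate entry for an odd prime `p ∣ Δ`: `s = ⌊√p⌋` (primality by trial division), the
exponent `e ≥ 1` of `p` in `Δ`, and the `kind` of the local certificate with its datum `t`: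
`kind = 0` non-split multiplicative (`t` ignored; Euler's criterion is checked on the nodal
discriminant), `kind = 1` split multiplicative (`t` a root of the node-tangent quadratic mod `p`),
`kind = 2` additive with `p ≥ 5` (`t = ord_p c₄`; Rohrlich's formula). [folklore] -/
structure OddEntry where
  /-- the prime -/
  p : ℕ
  /-- `⌊√p⌋` -/
  s : ℕ
  /-- exponent of `p` in `Δ` -/
  e : ℕ
  /-- `0` non-split multiplicative, `1` split multiplicative, `2` additive (`p ≥ 5`) -/
  kind : ℕ
  /-- root of the node-tangent quadratic mod `p` (`kind = 1`); `ord_p c₄` (`kind = 2`) -/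
  t : ℤ
  deriving DecidableEq

/-- The local check at an odd bad prime: multiplicative (`p ∤ c₄`) non-split by an Euler witness
or split by a root; additive (`p ≥ 5`, `p ∣ c₄`) by the exact valuations `pᵉ ∥ Δ`, `pᵗ ∥ c₄` with
`e < 12` or `t < 4` (minimality at `p`). [folklore] -/
def OddEntry.check (W₀ : WeierstrassCurve ℤ) (E : OddEntry) : Bool :=
  GoldbachLinnik.primeCert E.p (E.s + 1) && decide (E.p ≠ 2) && decide (1 ≤ E.e) &&
    (if E.kind = 0 then
      decide (¬ (E.p : ℤ) ∣ W₀.c₄) && (binPowMod ((nodalDisc W₀ % (E.p : ℤ)).toNat) (E.p / 2) E.p == E.p - 1)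
     else if E.kind = 1 then decide (¬ (E.p : ℤ) ∣ W₀.c₄) && decide ((E.p : ℤ) ∣ nodalValue W₀ E.t)
     else decide (5 ≤ E.p) && exactPow E.p E.e W₀.Δ && decide ((E.p : ℤ) ∣ W₀.c₄) &&
       exactPow E.p E.t.toNat W₀.c₄ && decide (E.e < 12 ∨ E.t.toNat < 4))

/-- The certified local root number at the entry's prime: `+1` non-split, `−1` split,
`rohrlichSign p e (ord_p c₄)` additive. [cite: Rohrlich1993Compositio, Prop. 2] -/
def OddEntry.value (E : OddEntry) : ℤ :=
  if E.kind = 0 then 1 else if E.kind = 1 then -1 else rohrlichSign E.p E.e (some E.t.toNat)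

/-- A root-number certificate of an integer equation: the `2`-adic valuations of `Δ, c₄, c₆` and one
`OddEntry` per odd prime dividing `Δ`. [folklore] -/
structure RNCert where
  /-- `v₂(Δ)` -/
  k2 : ℕ
  /-- `v₂(c₄)` (ignored if `c₄ = 0`) -/
  k4 : ℕ
  /-- `v₂(c₆)` (ignored if `c₆ = 0`) -/
  k6 : ℕ
  /-- the odd primes of bad reduction -/
  odd : List OddEntry
  deriving DecidableEq

/-- The certificate check (kernel-decidable): the `2`-adic valuations are exact, the odd primes are
distinct primes each passing its local check, and `|Δ| = 2^{k2} ∏ p^{e}` (no other bad prime).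
[folklore] -/
def RNCert.check (W₀ : WeierstrassCurve ℤ) (c : RNCert) : Bool :=
  exactPow 2 c.k2 W₀.Δ && (decide (W₀.c₄ = 0) || exactPow 2 c.k4 W₀.c₄) &&
    (decide (W₀.c₆ = 0) || exactPow 2 c.k6 W₀.c₆) && decide ((c.odd.map OddEntry.p).Nodup) &&
    c.odd.all (OddEntry.check W₀) &&
    decide (W₀.Δ.natAbs = 2 ^ c.k2 * (c.odd.map fun E => E.p ^ E.e).prod)

/-- The certified value of `∏ᵥ W.tableLocalRootNumberAt' v`: the `ℚ₂` table value times the odd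
local signs. [folklore] -/
def RNCert.sign (W₀ : WeierstrassCurve ℤ) (c : RNCert) : ℤ :=
  w2OfInt W₀.c₄ W₀.c₆ W₀.Δ c.k4 c.k6 c.k2 * (c.odd.map OddEntry.value).prod

section Soundness

variable {W₀ : WeierstrassCurve ℤ} {c : RNCert}

/-- Unpacking a checking certificate. [folklore] -/
theorem RNCert.check_spec (hc : c.check W₀ = true) :
    exactPow 2 c.k2 W₀.Δ = true ∧ (W₀.c₄ = 0 ∨ exactPow 2 c.k4 W₀.c₄ = true) ∧
      (W₀.c₆ = 0 ∨ exactPow 2 c.k6 W₀.c₆ = true) ∧ (c.odd.map OddEntry.p).Nodup ∧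
      (∀ E ∈ c.odd, E.check W₀ = true) ∧
      W₀.Δ.natAbs = 2 ^ c.k2 * (c.odd.map fun E => E.p ^ E.e).prod := by
  simp only [RNCert.check, Bool.and_eq_true, Bool.or_eq_true, decide_eq_true_eq,
    List.all_eq_true] at hc
  tauto

/-- Unpacking an entry check. [folklore] -/
theorem OddEntry.check_spec {E : OddEntry} (h : E.check W₀ = true) :
    E.p.Prime ∧ E.p ≠ 2 ∧ 1 ≤ E.e ∧
      (E.kind = 0 → ¬ (E.p : ℤ) ∣ W₀.c₄ ∧
        binPowMod ((nodalDisc W₀ % (E.p : ℤ)).toNat) (E.p / 2) E.p = E.p - 1) ∧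
      (E.kind = 1 → ¬ (E.p : ℤ) ∣ W₀.c₄ ∧ (E.p : ℤ) ∣ nodalValue W₀ E.t) ∧
      (E.kind ≠ 0 → E.kind ≠ 1 → 5 ≤ E.p ∧ exactPow E.p E.e W₀.Δ = true ∧ (E.p : ℤ) ∣ W₀.c₄ ∧
        exactPow E.p E.t.toNat W₀.c₄ = true ∧ (E.e < 12 ∨ E.t.toNat < 4)) := by
  unfold OddEntry.check at h
  by_cases h0 : E.kind = 0
  · simp only [h0, ↓reduceIte, Bool.and_eq_true, decide_eq_true_eq, beq_iff_eq] at h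
    exact ⟨GoldbachLinnik.prime_of_primeCert h.1.1.1, h.1.1.2, h.1.2, fun _ ↦ h.2, fun h1 ↦ by omega,
      fun h' ↦ absurd h0 h'⟩
  by_cases h1 : E.kind = 1
  · simp only [h1, one_ne_zero, ↓reduceIte, Bool.and_eq_true, decide_eq_true_eq] at h
    exact ⟨GoldbachLinnik.prime_of_primeCert h.1.1.1, h.1.1.2, h.1.2, fun h0' ↦ by omega, fun _ ↦ h.2,
      fun _ h' ↦ absurd h1 h'⟩
  · simp only [h0, h1, ↓reduceIte, Bool.and_eq_true, decide_eq_true_eq] at h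
    exact ⟨GoldbachLinnik.prime_of_primeCert h.1.1.1, h.1.1.2, h.1.2, fun h0' ↦ absurd h0' h0,
      fun h1' ↦ absurd h1' h1, fun _ _ ↦ ⟨h.2.1.1.1.1, h.2.1.1.1.2, h.2.1.1.2, h.2.1.2, h.2.2⟩⟩

/-- A checking certificate has `Δ ≠ 0`: the curve is elliptic. [folklore] -/
theorem isElliptic_of_check (hc : c.check W₀ = true) : (W₀.baseChange ℚ).IsElliptic :=
  WeierstrassCurve.isElliptic_baseChange_int _ (ne_zero_of_exactPow (RNCert.check_spec hc).1)

/-- Every prime factor of `Δ` is `2` or listed. [folklore] -/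
theorem mem_of_prime_dvd (hc : c.check W₀ = true) {p : ℕ} (hp : p.Prime)
    (hpd : (p : ℤ) ∣ W₀.Δ) : p ∈ 2 :: c.odd.map OddEntry.p := by
  obtain ⟨-, -, -, -, hall, hfac⟩ := RNCert.check_spec hc
  have h1 : p ∣ W₀.Δ.natAbs := Int.natCast_dvd.mp hpd
  rw [hfac] at h1
  rcases (Nat.Prime.dvd_mul hp).mp h1 with h | h
  · exact List.mem_cons.mpr (Or.inl ((Nat.prime_dvd_prime_iff_eq hp Nat.prime_two).mp
      (hp.dvd_of_dvd_pow h)))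
  · obtain ⟨a, ha, hpa⟩ := (Prime.dvd_prod_iff hp.prime).mp h
    obtain ⟨E, hE, rfl⟩ := List.mem_map.mp ha
    have hE' := (OddEntry.check_spec (hall E hE)).1
    refine List.mem_cons.mpr (Or.inr (List.mem_map.mpr ⟨E, hE, ?_⟩))
    exact ((Nat.prime_dvd_prime_iff_eq hp hE').mp (hp.dvd_of_dvd_pow hpa)).symm

/-- The guard of the named fact at `3`: `3 ∤ Δ` or `3 ∤ c₄` (a listed `3` is multiplicative, since
additive entries have `p ≥ 5`). [folklore] -/
theorem not_three_dvd_or_of_check (hc : c.check W₀ = true) :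
    ¬ (3 : ℤ) ∣ W₀.Δ ∨ ¬ (3 : ℤ) ∣ W₀.c₄ := by
  by_cases hpd : ((3 : ℕ) : ℤ) ∣ W₀.Δ
  · right
    rcases List.mem_cons.mp (mem_of_prime_dvd hc Nat.prime_three hpd) with h | h
    · exact absurd h (by decide)
    · obtain ⟨E, hE, hEp⟩ := List.mem_map.mp h
      obtain ⟨-, -, -, h0, h1, h2⟩ := OddEntry.check_spec ((RNCert.check_spec hc).2.2.2.2.1 E hE)
      by_cases hk0 : E.kind = 0
      · exact_mod_cast hEp ▸ (h0 hk0).1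
      by_cases hk1 : E.kind = 1
      · exact_mod_cast hEp ▸ (h1 hk1).1
      · have := (h2 hk0 hk1).1; omega
  · exact Or.inl (by exact_mod_cast hpd)

/-- The local root number at a listed odd prime is the certified sign (split: a root, `−1`;
non-split: Euler witness, `+1`; additive, `p ≥ 5`: Rohrlich's formula from `ord_p Δ`, `ord_p c₄`).
[cite: Rohrlich1993Compositio, Prop. 2] -/
theorem localRootNumberAt_natPlace_eq_value (hc : c.check W₀ = true) {E : OddEntry}
    (hE : E ∈ c.odd) :
    haveI := isElliptic_of_check hc
    (W₀.baseChange ℚ).localRootNumberAt (natPlace E.p) = E.value := by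
  haveI := isElliptic_of_check hc
  obtain ⟨-, -, -, -, hall, hfac⟩ := RNCert.check_spec hc
  obtain ⟨hp, hp2, he, h0, h1, h2⟩ := OddEntry.check_spec (hall E hE)
  have hv : natGenerator (natPlace E.p) = E.p := natGenerator_natPlace hp
  have hΔ : (E.p : ℤ) ∣ W₀.Δ := by
    have h1 : E.p ^ E.e ∣ W₀.Δ.natAbs := by
      rw [hfac]
      exact (List.dvd_prod (List.mem_map.mpr ⟨E, hE, rfl⟩)).mul_left _
    exact Int.natCast_dvd.mpr ((dvd_pow_self _ (by omega)).trans h1)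
  unfold OddEntry.value
  by_cases hk0 : E.kind = 0
  · simp only [hk0, ↓reduceIte]
    have key := pow_eq_neg_one_of_binPowMod hp (h0 hk0).2
    have key' : ∀ q, q = E.p → ((nodalDisc W₀ : ℤ) : ZMod q) ^ (q / 2) = -1 := by
      rintro q rfl; exact key
    exact localRootNumberAt_eq_one_of_pow_eq_neg_one (v := natPlace E.p) (by rw [hv]; exact hΔ)
      (by rw [hv]; exact (h0 hk0).1) (by rw [hv]; exact hp2) (key' _ hv)
  by_cases hk1 : E.kind = 1
  · simp only [hk1, one_ne_zero, ↓reduceIte]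
    exact localRootNumberAt_eq_neg_one_of_root (v := natPlace E.p) (by rw [hv]; exact hΔ)
      (by rw [hv]; exact (h1 hk1).1) (t := E.t) (by rw [hv]; exact (h1 hk1).2)
  · simp only [hk0, hk1, ↓reduceIte]
    obtain ⟨h5, heΔ, hc4, htc, hmin⟩ := h2 hk0 hk1
    have heΔ' := exactPow_spec heΔ
    have htc' := exactPow_spec htc
    rw [← hv] at h5 heΔ' htc' hc4
    rw [localRootNumberAt_eq_rohrlichSign (v := natPlace E.p) h5 he heΔ'.1 heΔ'.2
      (hmin.imp_right fun h4 h ↦ htc'.2 (dvd_trans (pow_dvd_pow _ (by omega)) h)) hc4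
      (some E.t.toNat) (by simp) (by rintro k ⟨rfl⟩; exact htc'), hv]

/-- **Soundness of root-number certificates**: for a checking certificate,
`∏ᶠ_v W.tableLocalRootNumberAt' v = c.sign` (`W = W₀ ⊗ ℚ`): the corrected `ℚ₂` table value at
the place of `2` (`w2OfInvariants'_intCast`), the certified signs at the odd bad primes, `1`
elsewhere. [cite: KellockDokchitser2023, Def. 2.1, Thm. 2.3 and §5] -/
theorem finprod_tableLocalRootNumberAt'_eq_sign (hc : c.check W₀ = true) :
    ∏ᶠ v, (W₀.baseChange ℚ).tableLocalRootNumberAt' v = c.sign W₀ := by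
  haveI := isElliptic_of_check hc
  obtain ⟨hk2, hk4, hk6, hnd, hall, -⟩ := RNCert.check_spec hc
  have hprime : ∀ p ∈ 2 :: c.odd.map OddEntry.p, p.Prime := by
    intro p hp
    rcases List.mem_cons.mp hp with rfl | h
    · exact Nat.prime_two
    · obtain ⟨E, hE, rfl⟩ := List.mem_map.mp h
      exact (OddEntry.check_spec (hall E hE)).1
  have hnd' : (2 :: c.odd.map OddEntry.p).Nodup := by
    refine List.nodup_cons.mpr ⟨fun h ↦ ?_, hnd⟩
    obtain ⟨E, hE, hE2⟩ := List.mem_map.mp h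
    exact (OddEntry.check_spec (hall E hE)).2.1 hE2
  rw [finprod_tableLocalRootNumberAt'_eq_prod (W₀ := W₀) _ hnd' List.mem_cons_self hprime
    (fun p hp hpd ↦ mem_of_prime_dvd hc hp hpd), List.map_cons, List.prod_cons, RNCert.sign,
    List.map_map]
  congr 1
  · rw [tableLocalRootNumberAt'_eq_ite, if_pos (natGenerator_natPlace Nat.prime_two),
      rootNumberTwo'_def, baseChange_int_c₄, baseChange_int_c₆, baseChange_int_Δ]
    exact w2OfInvariants'_intCast _ _ _ _ _ _ hk4 hk6 hk2
  · congr 1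
    refine List.map_congr_left fun E hE ↦ ?_
    have hp := (OddEntry.check_spec (hall E hE)).1
    have hp2 := (OddEntry.check_spec (hall E hE)).2.1
    rw [Function.comp_apply, tableLocalRootNumberAt'_eq_ite, natGenerator_natPlace hp, if_neg hp2]
    exact localRootNumberAt_natPlace_eq_value hc hE

/-- **The global root number from a certificate, modulo the named fact**: if `c.check W₀` and the
tree's named fact `rootNumber_eq_neg_finprod_tableLocalRootNumberAt'` (Kellock–Dokchitser 2023,
Thm. 2.3 + §5, rows `(0,5,2)` corrected after Rizzo 2003) holds for `W₀ ⊗ ℚ`, then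
`w(W₀ ⊗ ℚ) = −c.sign` (the guard at `3` is discharged by the certificate).
[cite: KellockDokchitser2023, Thm. 2.3 and §5] -/
theorem rootNumber_eq_neg_sign (hc : c.check W₀ = true)
    (hKD : (W₀.baseChange ℚ).rootNumber_eq_neg_finprod_tableLocalRootNumberAt') :
    (W₀.baseChange ℚ).rootNumber = -c.sign W₀ := by
  haveI := isElliptic_of_check hc
  rw [← finprod_tableLocalRootNumberAt'_eq_sign hc]
  exact hKD (guard_three (not_three_dvd_or_of_check hc))

end Soundness

/-! ### Kernel self-test: `5077a1 = [0,0,1,−7,6]` (`Δ = 5077` prime, NON-split: `w₅₀₇₇ = +1`, `w = −w₂·w₅₀₇₇ = −1`) -/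

example : RNCert.check ⟨0, 0, 1, -7, 6⟩ ⟨0, 4, 3, [⟨5077, 71, 1, 0, 0⟩]⟩ = true := by
  decide +kernel

end Summit.BirchSwinnertonDyer.BirchSwinnertonDyer.Rank2Observatory.RootNumber
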